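import Summits.QuantumFields.BalabanUV.Beta.EriceRemainderEnclosureHistoryAutonomyComparisonAgeCompositionThreeAgesDefectReduction

/-!
# EriceRemainderEnclosureHistoryAutonomyComparisonAgeCompositionThreeAgesDefectAbsReduction — (E87o) route (N), first order, THREE loaded ages: the per-pair family (S-h°) ((E87k);
# the hpair23 member of (E87n)'s sockets) REDUCED to the damping-free, chain-free product inequality (★h°) — (★h♯) of (E87i) with the young lower masses' lag-wise factor
# `max((1−ρUp)(1−k₃c), 1 − k₃c − k₂q, 0)` in place of `(1 − k₃c_{m+2})·max(1−ρUp, 0)`: no clipping hole where the chain-ratio majorant exceeds `1`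

Cell `pub-balaban`, β-function sub-cell, BINDER row D4 «RemainderConst leaves for Bałaban's split» (`HOME/BINDER-OWNERS.md`; owner lineage `b2b-balaban-beta-an4`;
this file by co-owner #2 lineage `b2b-balaban-beta-d4-p2`, generation 78), β-FLOW TEAM duty (1), FREEZE (0) honoured (def-free; imports (E87i); uses (E75a) `defect_nonneg`, (E82b) `kernel_entry_le` ∕
`row_mass_le`, (E84a) `inv_prod_le_prod_damping` BY NAME; (E87i) §3 copied with the young factor re-cut; nothing else restated).

HONEST FRAMING (page 1, verbatim and binding).  *"Discharging BetaPertH makes Bałaban's UV stability UNCONDITIONAL — a real constructive-QFT result; it is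
NOT the continuum limit and NOT the Clay problem."*  THIS FILE DISCHARGES NOTHING OF THE KIND.  Elementary real analysis about ABSTRACT functionals on a box
]0,γ]^ℕ with displayed floors, profiles and signs, and the FIRST-ORDER renewal objects of route (N) built from them — hypotheses of a census, not facts; the
form, signs, ages and moments of Bałaban's (1.22) limit functional are NOT PRINTED ([I] p. 298; GAPS G-t4-U2-1∕-2) and NOT asserted.  Row D4 class
UNCHANGED (critical-path width 0; instance 0∕1; D4 DISCHARGE NO DATE).  HONEST DEPENDENCY: continuum YM on T⁴ ⇐ BetaPertH ∧ nine spine estimates (0/9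
proved); BetaPertH ⇐ (D1) ∧ (D4) ∧ CAP+tail; G-an2-4 gates asym, D1 and NE2/3/4.

THE POINT (census sense (α); route (N); README `HOME/b2b-balaban-beta-d4-p2/g78/e87/README.md` §3–§4).  §1 **`static_defect_abs_of_product`**: at a pin `m`,
for every truncation `j ≥ m+1+k₃`, the (S-h°) member of (E87n)'s `hpair23` (absolute young lower masses `TA`, letter `Tτ` displayed with an older-mass function
`XA ≤ k₃c`) from **(★h°)**: `r_m·q_{m+1+k₃}·#{l<k₂ : m+2+k₃+l ≤ j} ≤ (1−r_m)·Σ_{l'<k₃} Pf(m+1+l',m+k₃)·ALa_j(m+1+l') + r_m·Pf(m+1,m+k₃)·ALa_j(m+1)`,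
`ALa_j(p) = q_p·Σ_{l<k₂} [p+1+l ≤ j]·Pf(p+1+l,p+k₂)·τlo(p+1+l)`, `τlo(p') = max((1−ρUp_{p'})(1 − k₃c_{p'}), 1 − k₃c_{p'} − k₂q_{p'}, 0)` — levels and loads
only.  Census g78 (`shcomb.py`, bench three-age flows, pins `≤ 2`): (★h°) log-ratio `−0.60∕−0.45∕−0.34` (`k₃ = 8∕16∕32`; (★h♯): `−0.53∕−0.39∕−0.29`); large
`k₃` and the adversarial census: README.  The socket ON (★h°) is the companion file `…ThreeAgesDefectAbs`.  NOT CLAIMED: (★h°) along flows (successor);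
anything nonlinear; anything printed — NOT B12 Thm 2, NOT BetaPertH.

WHAT IS PROVED ([folklore]; 0 `def`, 0 sorry).  §1 **`static_defect_abs_of_product`**.
-/
noncomputable section
open Finset

namespace Summit.QuantumFields.BalabanUV.Beta.EriceRemainderEnclosureHistoryAutonomyComparisonAgeCompositionThreeAgesDefectAbsReduction

open Literature.MathematicalPhysics.QuantumFieldTheory.Balaban1983to89
open Literature.MathematicalPhysics.QuantumFieldTheory.Balaban1983to89.T4BetaStationary
open Literature.MathematicalPhysics.QuantumFieldTheory.Balaban1983to89.T4BetaFlowWellPosed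
open Summit.QuantumFields.BalabanUV.Beta.EriceRemainderEnclosureHistoryAutonomyComparisonAgeCompositionIdentification (defect_nonneg)
open Summit.QuantumFields.BalabanUV.Beta.EriceRemainderEnclosureHistoryAutonomyComparisonAgeCompositionYoungestTailSumFlow (kernel_entry_le row_mass_le)
open Summit.QuantumFields.BalabanUV.Beta.EriceRemainderEnclosureHistoryAutonomyComparisonAgeCompositionDecayReduction (inv_prod_le_prod_damping)

variable {B : (ℕ → ℝ) → ℝ} {γ b gIR : ℝ} {L : ℕ → ℝ} {K : ℕ} {h g : ℕ → ℝ} {KL θ : ℕ → ℕ → ℕ → ℝ} {ρ : ℕ → ℕ → ℝ}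

/-! ## §1 (S-h°) at a pin from the damping-free product inequality (★h°) -/

/-- **(S-h°) AT A PIN FROM THE DAMPING-FREE, CHAIN-FREE PRODUCT INEQUALITY (★h°).**  As (E87i) `static_defect_sup_of_product`, but for the absolute young
lower masses of (S-h°): the letter `Tτ m p' = max((1−ρ k₂ p')(1 − XA(m+2)), (1−ρ k₂ p')(1 − XA p'), 1 − XA p' − Σ_l KL k₂ p' l, 0)` with any `XA ≤ k₃c` at the
pins `≥ 1`, `TA_j(m,p) = Σ_{l<k₂} [p+1+l ≤ j]·KL k₂ p l·Tτ m (p+1+l)`; the levels-and-loads minorants `τlo(p') = max((1−ρUp_{p'})(1 − k₃c_{p'}), 1 − k₃c_{p'} − k₂q_{p'},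
0) ≤ Tτ m p'` (`ρ k₂ ≤ ρUp` at the pins `≥ 2`, `ρ k₂ ≤ 1`, `k₃c ≤ 3∕4` at the pins `≥ 1`) and `ALa_j(p) = q_p·Σ_l [p+1+l ≤ j]·Pf(p+1+l,p+k₂)·τlo(p+1+l)`.  IF
(★h°) holds at `m` for every `j ≥ m+1+k₃`, THEN the (S-h°) member holds at `m`. [folklore] -/
theorem static_defect_abs_of_product (hL : ∀ k, 0 ≤ L k) (hh : SeqBox γ h) (hanti : Antitone h)
    (hg : ∀ t, 0 < g t ∧ g t ≤ 1) (hgF : ∀ t, 1 / (1 + ∑ k ∈ range K, L k * h (t + k) ^ 3 / 2) ≤ g t)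
    {k₂ k₃ : ℕ} (hk2 : 2 ≤ k₂) (hk23 : k₂ < k₃) (hk3K : k₃ < K)
    (hKL : ∀ k n l, KL k n l = if 0 < k ∧ k < K ∧ l < k then L k * h (n + k) ^ 3 / 2 * ∏ t ∈ Ico (n + 1 + l) (n + k + 1), g t else 0)
    (hθ : ∀ k n l, θ k n l = 1 - (h (n + k + l) / h (n + k)) ^ 3 * ∏ t ∈ Ico (n + k + 1) (n + k + l + 1), g t)
    (hρ1 : ∀ p, ρ k₂ p ≤ 1)
    {q c F ρUp XA τlo : ℕ → ℝ} {Pf Tτ ALa : ℕ → ℕ → ℝ} {TA : ℕ → ℕ → ℕ → ℝ}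
    (hq : ∀ n, q n = L k₂ * h (n + k₂) ^ 3 / 2) (hc : ∀ n, c n = L k₃ * h (n + k₃) ^ 3 / 2)
    (hF : ∀ t, F t = ∑ j ∈ range K, L j * h (t + j) ^ 3 / 2) (hPf : ∀ a b, Pf a b = (∏ t ∈ Ico a (b + 1), (1 + F t))⁻¹)
    (hx34 : ∀ n, 1 ≤ n → k₃ * c n ≤ 3 / 4) (hXA : ∀ p, 1 ≤ p → XA p ≤ k₃ * c p)
    (hTτ : ∀ m p', Tτ m p' = max (max (max ((1 - ρ k₂ p') * (1 - XA (m + 2))) ((1 - ρ k₂ p') * (1 - XA p')))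
      ((1 - XA p') - ∑ l ∈ range K, KL k₂ p' l)) 0)
    (hTA : ∀ j m p, TA j m p = ∑ l ∈ range k₂, if p + 1 + l ≤ j then KL k₂ p l * Tτ m (p + 1 + l) else 0)
    (hρle : ∀ p, 2 ≤ p → ρ k₂ p ≤ ρUp p)
    (hτlo : ∀ p', τlo p' = max (max ((1 - ρUp p') * (1 - k₃ * c p')) (1 - k₃ * c p' - k₂ * q p')) 0)
    (hALa : ∀ j p, ALa j p = q p * ∑ l ∈ range k₂, if p + 1 + l ≤ j then Pf (p + 1 + l) (p + k₂) * τlo (p + 1 + l) else 0)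
    {m : ℕ}
    (hprod : ∀ j, m + 1 + k₃ ≤ j →
      (h (m + k₃ + 1) / h (m + k₃)) ^ 3 * q (m + 1 + k₃) * (∑ l ∈ range k₂, if m + 2 + k₃ + l ≤ j then (1:ℝ) else 0) ≤
        (1 - (h (m + k₃ + 1) / h (m + k₃)) ^ 3) * ∑ l' ∈ range k₃, Pf (m + 1 + l') (m + k₃) * ALa j (m + 1 + l') +
          (h (m + k₃ + 1) / h (m + k₃)) ^ 3 * (Pf (m + 1) (m + k₃) * ALa j (m + 1))) :
    ∀ j, m + 1 + k₃ ≤ j →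
      KL k₃ (m + 1) (k₃ - 1) * ∑ l ∈ range k₂, (if m + 2 + k₃ + l ≤ j then KL k₂ (m + 1 + k₃) l else 0) ≤
        (1 - (1 - θ k₃ m 1)) * ∑ l' ∈ range k₃, KL k₃ m l' * TA j m (m + 1 + l') + (1 - θ k₃ m 1) * (KL k₃ m 0 * TA j m (m + 1)) := by
  intro j hj
  have hpos : ∀ n, 0 < h n := fun n => (hh n).1
  have hk2K : k₂ < K := by omega
  have hF0 : ∀ t, 0 ≤ F t := fun t => by
    rw [hF]; exact sum_nonneg fun j _ => by have := hL j; have := hpos (t + j); positivity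
  have hgF' : ∀ t, 1 / (1 + F t) ≤ g t := fun t => by rw [hF]; exact hgF t
  have hq0 : ∀ n, 0 ≤ q n := fun n => by rw [hq]; have := hL k₂; have := hpos (n + k₂); positivity
  have hc0 : ∀ n, 0 ≤ c n := fun n => by rw [hc]; have := hL k₃; have := hpos (n + k₃); positivity
  have hPf0 : ∀ a b, 0 ≤ Pf a b := fun a b => by rw [hPf]; exact inv_nonneg.mpr (prod_nonneg fun t _ => by have := hF0 t; positivity)
  -- the letters of the pin: r, G
  set r : ℝ := (h (m + k₃ + 1) / h (m + k₃)) ^ 3 with hr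
  set G : ℝ := g (m + k₃ + 1) with hG
  have hr0 : 0 ≤ r := by have := hpos (m + k₃ + 1); have := hpos (m + k₃); positivity
  have hG0 : 0 < G := (hg _).1
  have hG1 : G ≤ 1 := (hg _).2
  have hr3 : h (m + k₃ + 1) ^ 3 = r * h (m + k₃) ^ 3 := by
    rw [hr, div_pow, div_mul_cancel₀ _ (pow_ne_zero 3 (hpos _).ne')]
  have hent : KL k₃ (m + 1) (k₃ - 1) = r * c m * G := by
    rw [hKL, if_pos ⟨by omega, hk3K, by omega⟩, show m + 1 + 1 + (k₃ - 1) = m + k₃ + 1 by omega, show m + 1 + k₃ + 1 = m + k₃ + 1 + 1 by ring,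
      Nat.Ico_succ_singleton, prod_singleton, hc, show m + 1 + k₃ = m + k₃ + 1 by ring, hr3]
    ring
  have hθm : θ k₃ m 1 = 1 - r * G := by rw [hθ, Nat.Ico_succ_singleton, prod_singleton]
  have hθ0 : 0 ≤ 1 - r * G := by have := defect_nonneg hpos hanti hg hθ k₃ m 1; rwa [hθm] at this
  -- LEFT: the young entries below their undamped coefficients
  have hleft : KL k₃ (m + 1) (k₃ - 1) * ∑ l ∈ range k₂, (if m + 2 + k₃ + l ≤ j then KL k₂ (m + 1 + k₃) l else 0) ≤
      c m * G * (r * q (m + 1 + k₃) * ∑ l ∈ range k₂, if m + 2 + k₃ + l ≤ j then (1:ℝ) else 0) := by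
    have hS : ∑ l ∈ range k₂, (if m + 2 + k₃ + l ≤ j then KL k₂ (m + 1 + k₃) l else 0) ≤
        q (m + 1 + k₃) * ∑ l ∈ range k₂, (if m + 2 + k₃ + l ≤ j then (1:ℝ) else 0) := by
      rw [mul_sum]
      refine sum_le_sum fun l hl => ?_
      have hlk : l < k₂ := mem_range.mp hl
      split_ifs
      · have := (kernel_entry_le hL hh hg hKL k₂ (m + 1 + k₃) l).2
        rw [if_pos hlk, ← hq] at this; linarith
      · simp
    rw [hent, show r * c m * G * _ = c m * G * (r * ∑ l ∈ range k₂, (if m + 2 + k₃ + l ≤ j then KL k₂ (m + 1 + k₃) l else 0)) by ring]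
    exact mul_le_mul_of_nonneg_left (by nlinarith [mul_le_mul_of_nonneg_left hS hr0]) (mul_nonneg (hc0 m) hG0.le)
  -- RIGHT: the old entries at the floor, the young lower masses below `TA`
  have hτlo0 : ∀ p', 0 ≤ τlo p' := fun p' => by rw [hτlo]; exact le_max_right _ _
  have hτle : ∀ p', m + 2 ≤ p' → τlo p' ≤ Tτ m p' := by
    intro p' hp'
    have hX : XA p' ≤ k₃ * c p' := hXA p' (by omega)
    have hx30 : ∀ n, 1 ≤ n → k₃ * c n ≤ 3 / 4 := hx34
    have hq2 : ∑ l ∈ range K, KL k₂ p' l ≤ k₂ * q p' := by rw [hq]; exact row_mass_le hL hh hg hKL hk2K p'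
    have hρ0 : 0 ≤ 1 - ρ k₂ p' := by linarith [hρ1 p']
    have hb2 : (1 - ρUp p') * (1 - k₃ * c p') ≤ (1 - ρ k₂ p') * (1 - XA p') := by
      rcases le_or_gt 0 (1 - ρUp p') with hpos | hneg
      · exact mul_le_mul (by linarith [hρle p' (by omega)]) (by linarith) (by linarith [hx30 p' (by omega)]) hρ0
      · have : (1 - ρUp p') * (1 - k₃ * c p') ≤ 0 := mul_nonpos_of_nonpos_of_nonneg hneg.le (by linarith [hx30 p' (by omega)])
        exact this.trans (mul_nonneg hρ0 (by linarith [hx30 p' (by omega)]))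
    have hb3 : 1 - k₃ * c p' - k₂ * q p' ≤ (1 - XA p') - ∑ l ∈ range K, KL k₂ p' l := by linarith
    rw [hτlo, hTτ]
    exact max_le (max_le (le_max_of_le_left (le_max_of_le_left (le_max_of_le_right hb2))) (le_max_of_le_left (le_max_of_le_right hb3))) (le_max_right _ _)
  have hALo0 : ∀ p, 0 ≤ ALa j p := fun p => by
    rw [hALa]; exact mul_nonneg (hq0 p) (sum_nonneg fun l _ => by split_ifs <;> [exact mul_nonneg (hPf0 _ _) (hτlo0 _); exact le_rfl])
  have hALge : ∀ p, m + 1 ≤ p → ALa j p ≤ TA j m p := by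
    intro p hp
    rw [hALa, hTA, mul_sum]
    refine sum_le_sum fun l hl => ?_
    have hlk : l < k₂ := mem_range.mp hl
    split_ifs with hpl
    · have hfloor : q p * Pf (p + 1 + l) (p + k₂) ≤ KL k₂ p l := by
        rw [hKL, if_pos ⟨by omega, hk2K, hlk⟩, ← hq, hPf]
        exact mul_le_mul_of_nonneg_left (inv_prod_le_prod_damping hF0 hgF' _) (hq0 p)
      have hprod' : (q p * Pf (p + 1 + l) (p + k₂)) * τlo (p + 1 + l) ≤ KL k₂ p l * Tτ m (p + 1 + l) :=
        mul_le_mul hfloor (hτle (p + 1 + l) (by omega)) (hτlo0 _) (kernel_entry_le hL hh hg hKL k₂ p l).1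
      linarith
    · simp
  have hold : ∀ l', l' < k₃ → c m * Pf (m + 1 + l') (m + k₃) ≤ KL k₃ m l' := fun l' hl' => by
    rw [hKL, if_pos ⟨by omega, hk3K, hl'⟩, ← hc, hPf]
    exact mul_le_mul_of_nonneg_left (inv_prod_le_prod_damping hF0 hgF' _) (hc0 m)
  set A' : ℝ := ∑ l' ∈ range k₃, Pf (m + 1 + l') (m + k₃) * ALa j (m + 1 + l') with hA'
  set B' : ℝ := Pf (m + 1) (m + k₃) * ALa j (m + 1) with hB'
  have hA0 : 0 ≤ A' := sum_nonneg fun l' _ => mul_nonneg (hPf0 _ _) (hALo0 _)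
  have hB0 : 0 ≤ B' := mul_nonneg (hPf0 _ _) (hALo0 _)
  have hAle : c m * A' ≤ ∑ l' ∈ range k₃, KL k₃ m l' * TA j m (m + 1 + l') := by
    rw [hA', mul_sum]
    refine sum_le_sum fun l' hl' => ?_
    rw [← mul_assoc]
    exact mul_le_mul (hold l' (mem_range.mp hl')) (hALge _ (by omega)) (hALo0 _) (kernel_entry_le hL hh hg hKL k₃ m l').1
  have hBle : c m * B' ≤ KL k₃ m 0 * TA j m (m + 1) := by
    rw [hB', ← mul_assoc]
    have h0 := hold 0 (by omega); rw [add_zero] at h0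
    exact mul_le_mul h0 (hALge _ (by omega)) (hALo0 _) (kernel_entry_le hL hh hg hKL k₃ m 0).1
  have hright : c m * ((1 - r * G) * A' + r * G * B') ≤
      (1 - (1 - θ k₃ m 1)) * ∑ l' ∈ range k₃, KL k₃ m l' * TA j m (m + 1 + l') + (1 - θ k₃ m 1) * (KL k₃ m 0 * TA j m (m + 1)) := by
    rw [hθm, sub_sub_cancel]
    have := mul_le_mul_of_nonneg_left hAle hθ0
    have := mul_le_mul_of_nonneg_left hBle (mul_nonneg hr0 hG0.le)
    nlinarith
  -- (★h°) in the middle, and the one damping left over: G(1−r) ≤ 1 − rG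
  have hmid : c m * G * (r * q (m + 1 + k₃) * ∑ l ∈ range k₂, if m + 2 + k₃ + l ≤ j then (1:ℝ) else 0) ≤
      c m * G * ((1 - r) * A' + r * B') :=
    mul_le_mul_of_nonneg_left (by have := hprod j hj; rwa [← hA', ← hB'] at this) (mul_nonneg (hc0 m) hG0.le)
  have hlast : c m * G * ((1 - r) * A' + r * B') ≤ c m * ((1 - r * G) * A' + r * G * B') := by
    have hGr : G * (1 - r) ≤ 1 - r * G := by nlinarith
    have := mul_le_mul_of_nonneg_right hGr hA0
    nlinarith [mul_le_mul_of_nonneg_left this (hc0 m)]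
  exact hleft.trans (hmid.trans (hlast.trans hright))

end Summit.QuantumFields.BalabanUV.Beta.EriceRemainderEnclosureHistoryAutonomyComparisonAgeCompositionThreeAgesDefectAbsReduction

end
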